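import Summits.QuantumFields.YangMills.Theorems.BalabanUVNodesN07Thm4RecSym152PhiEGOfJunctionGlued
import Summits.QuantumFields.YangMills.Theorems.BalabanUVNodesN07JunctionHnumOfSmallness
import Summits.QuantumFields.YangMills.Theorems.BalabanUVNodesN07JunctionHJ
import Summits.QuantumFields.YangMills.Theorems.BalabanUVNodesN07DatumCrownPhiOfRecordCrownPrecomp
import Summits.QuantumFields.YangMills.Theorems.BalabanUVNodesN07RecordCrownSUPrecomp
import Summits.QuantumFields.YangMills.Theorems.BalabanUVNodesK0S5HBRows164CoreCubeSeq
import Summits.QuantumFields.YangMills.Theorems.BalabanUVNodesN07Prop8StepTokenOfRecordSym152GClosedB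
import HarnessLib

/-!
# N07 [B11] (= [15] = [Balaban1985Variational]) Sect. F ∕ K0⁷ — **MODULES 125 AND 140 (thms 2–3) AT PRINT's [II] (2.3) DATUM AND PRINT's (7) DATA, WITHOUT THE SEAM**: the K0⁷ stub-1–SHAPED
# ∃-text over `Prop8RegSepTopStepGB F 2 suppDom (grid guard) (lamDatum F) (dataSmall7LamTopOf F 2)` — (§1) from the collar-uniform conditional premise (P1-G) ALONE, (§2) from (P1′-G) at
# the print letters, (§3) from the record crown, hence ★★★ UNCONDITIONALLY for `N = 2`, `1 ≤ Mc` (`exists_prop8RegSepTopStepGB_lam`) — S1c of the (E1)∕(iii-b) work plan (director-ym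
# №338∕№339; FLAG №16; LOCATE-HSEAM 5d3298b8d191f169); V23 names this text, this file spells it out

Cell `pub-ymgap`, seat `pub-ymgap-dag-n07-e` g34 (FAN-OUT §N07 row s3; LANE OWNER of the K0 road chart side).  `--kind proof --supports stmt-QuantumFields-20541 --as helper` (K0⁷); count-neutral;
def-free; four theorems.  PRINT-DATUM TWINS of `…N07Prop8StepCoPGridGOfPremisesG.prop8StepCoPGridGAt_of_sym152PhiEG_uniform_of_seam ∕ _printLetters_of_seam` (125) and
`…N07JunctionHsupOfSmallness.prop8StepCoPGridGAt_of_recordCrown_of_seam ∕ prop8StepCoPGridGAt_of_seam` (140 thms 2–3) (FLAG №16 ∕ LOCATE-HSEAM 5d3298b8d191f169); the (b)-instances stay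
landed and true on their own text (conditionals displaying HSEAM; `not_hseam` ✓p765776 shows that binder uninhabited — vacuously true, not false).  HONESTY GUARD №338 (5), verbatim for 140′:
«no twin may delete or weaken a displayed premise other than the HSEAM binder that the datum change makes definitionally void (140′), and 140′'s docstring must say exactly that» — THIS
IS 140′: the ONLY premise removed is HSEAM; it is definitionally void at print's datum because the twin tokens' own fibre rows at `bd := lamDatum F` — `AgreeOnB (lamBondsSeq s.Ω k) (Ū U) W`,
`IsCritOnFibreB F N K (lamBondsSeq s.Ω k) W U` — ARE, unfolded (F0b `mem_lamBondsSeq_iff_lamBond` ∕ `isCritOnFibreB_lamBondsSeq_iff`), the agreement on [II] (2.3)'s cells «Λ_j = Ω_j^{(j)} ∖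
Ω_{j+1}^{(j)} … for the sets of sites and the sets of bonds» (p. 224; ruling (α): the DIFFERENCE of the bond sets — inward connectors belong to no `Λ_j`) and print's cell-form criticality there,
which is all HSEAM asserted; 77c⁵′ᴮ (p766698) derives them where 77c⁵ invoked `hseam`.  The CONCLUSION is RE-KEYED: not `K0V22ZDefs.Prop8StepCoPGridGAt F` (the V22-Z registered text over
the (b)-datum) but the SAME ∃-shape over `Prop8RegSepTopStepGB F 2 suppDom (grid guard) (lamDatum F) (dataSmall7LamTopOf F 2)` — spelled out here; V23 (planner) names it.
[15] = [Balaban1985Variational]; [6] = [Balaban1985RegularSpaces]; [3] = [Balaban1985Averaging]; [II] = [Balaban1984PropagatorsII]; [III] = [Balaban1988Convergent]; [I] = [Balaban1987RG1].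

ASSEMBLY (by name).  §1 = 125 §2's proof verbatim (the K0 witness's integers `a′ := M_h⁰ + md`, collar `ρ := ρ₀·L` with `ρ₀ := ρmin·M_h·t`, grid guard `c c₀ c₁`, collar letter by 120 §1
`collar_letter_eventually_linear`, `hThm4RecSym152PhiEG_mono`) over the print-datum closed head 124′ `prop8RegSepTopStepGB_of_hThm4RecSym152PhiEG_closed_lam` (← 123′ ← 122′ ← 77c⁵′ᴮ +
S1c-1 + 89⁵′ + 117′ᴮ + 99″ᴮ ← C2 readers + K0-core′ at `Ex0 := lamPlaqs0Of F`); §2 = 125 §3 (`b9OfP_le_linear`, `a0OfP_pos`); §3 = 140 thms 2–3: (P1-G) from the record crown by 140 thm 1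
`sym152PhiEG_uniform_of_recordCrown` (datum-free, UNCONDITIONAL ✓p764312) and the crown itself from dag-n05-e's `recordCrownSUPrecomp_holds_of_le F 2` (`2 ≤ 25`).
WHAT IS PROVED (sorry-free; no definition; axioms standard).  §1 ★★★ `exists_prop8RegSepTopStepGB_lam_of_sym152PhiEG_uniform (Mc) (hMc) (hTU)`; §2 ★★ `…_of_sym152PhiEG_printLetters`;
§3 ★★★ `exists_prop8RegSepTopStepGB_lam_of_recordCrown (Mc) (hMc) (hcrown)`, ★★★★ `exists_prop8RegSepTopStepGB_lam (F) (Mc) (hMc : 1 ≤ Mc)` — the stub-1-shaped text AT PRINT's DATUM with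
NO displayed premise.
HONEST SCOPE (binding).  This is the K0 chart road's end-to-end composition at print's datum for `N = 2`: [15] Prop. 8's guarded top step over the (2.3) fibre and print's (7) data, from the
tree's landed analysis of [15] Sect. F ∕ [6] Thm. 4 ∕ Prop. 6 ∕ the junction and the record crown.  It is NOT the registered V22-Z stub 1 (`K0V22ZDefs.Prop8StepCoPGridGAt F`, (b)-datum) and closes
NO registered statement; V23's registration (planner, director GO) decides what it closes.  K0⁷ stub 1 NOT closed; K0⁷ ∕ K1⁹ NOT closed; N07 NOT discharged (the chair books, the referee reads);
counts unmoved (typed 28∕28 · discharged 8∕28); one finite 𝕋⁴ programme at fixed ε — the route closes the conditional finite-𝕋⁴ rung `BalabanLadder.UV` ONLY; the YM mass gap (Clay) is NOT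
proved by any of this; nothing continuum ∕ ℝ⁴ ∕ OS.  No `def`, no `instance`, no `notation`, no `sorry`.

References: [15] Prop. 8 p. 304, (7) p. 278, (144) p. 300, (147)–(163) pp. 301–304; [6] Thm. 4 p. 88, Prop. 6 (1.130)–(1.138) p. 99, p. 98, Prop. 8 p. 100; [3] (26) p. 22, (78)–(81) p. 30;
[II] (2.3) p. 224 L10–16; [III] (2.1) p. 254, (2.5) p. 255, (2.10) p. 256; [I] (0.1) p. 251, p. 257, (0.4), (0.11) p. 253.
v1.1 (director-ym №365 (2)–(4), row group 13′ — IMPORT re-point + PRIVATE re-homes + every existing declaration BYTE-IDENTICAL; lint-clean in place, reverse cone 1): `import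
…N07JunctionHsupOfSmallness` (MODULE 140 — residue after the Stage-2 seam: its theorems 2–3 and, through MODULE 125 → 120, `…K0V22ZDefs`) ↦ MODULE 140's five green imports +
`…K0S5HBRows164CoreCubeSeq`; §0′ carries PRIVATE verbatim copies of the three residue-module theorems this road uses (120 §1 `collar_letter_eventually_linear`, 120 §3 `b9OfP_le_linear`,
140 thm 1 `sym152PhiEG_uniform_of_recordCrown`); the import closure of this file — hence of `…K0Stub1BHolds` — then meets NO residue module.
-/

set_option autoImplicit false

noncomputable section

open scoped BigOperators Matrix.Norms.L2Operator

namespace Summit.QuantumFields.YangMills.BalabanUVNodes.N07Prop8StepCoPGridGAtLam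

open Literature.MathematicalPhysics.QuantumFieldTheory.Balaban1983to89
open Literature.MathematicalPhysics.QuantumFieldTheory.Balaban1983to89.Node00
open Literature.MathematicalPhysics.QuantumFieldTheory.Balaban1983to89.B15DeterminingSets
open Literature.MathematicalPhysics.QuantumFieldTheory.Balaban1983to89.B15DeterminingSetsB
open T4Continuum (T4Family)
open GaugeField (gaugeAct)
open Summit.QuantumFields.YangMills.BalabanUVNodes.N07Thm4RecordStructureSym152PhiEG (HThm4RecSym152PhiEG hThm4RecSym152PhiEG_mono)
open Summit.QuantumFields.YangMills.BalabanUVNodes.N07Prop8StepTokenOfRecordSym152GClosedB (prop8RegSepTopStepGB_of_hThm4RecSym152PhiEG_closed_lam)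
open Summit.QuantumFields.YangMills.BalabanUVNodes.N07RecordCrownSUPrecomp (RecordCrownSUPrecomp RecordCrownSUPrecompBody recordCrownSUPrecomp_holds_of_le)
open Summit.QuantumFields.YangMills.BalabanUVNodes.N07DatumCrownPhiOfRecordCrownPrecomp (DatumCrownPhiAt datumCrownPhiAt_of_recordCrownSUPrecompBody)
open Summit.QuantumFields.YangMills.BalabanUVNodes.N07Thm4RecSym152PhiEGOfJunctionGlued (hThm4RecSym152PhiEG_of_junction_glued)
open Summit.QuantumFields.YangMills.BalabanUVNodes.N07JunctionHnumOfSmallness (hnum_of_smallness exists_fineLetter_small exists_kappa_choice)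
open Summit.QuantumFields.YangMills.BalabanUVNodes.N07JunctionHJ (hJ_holds)
open Summit.QuantumFields.YangMills.Theorems.K0S5HBRows164CoreCubeSeq (exists_collar_threshold)

variable (F : T4Family)

/-! ## §0′  PRIVATE RE-HOMES from the residue modules 120 ∕ 140 (director-ym №365 (2)–(4), row group 13′; statements + proofs verbatim, `private`) -/

/-- PRIVATE RE-HOME (director-ym №365 (2)–(4), row group 13′; R556): verbatim copy of `Summit.QuantumFields.YangMills.BalabanUVNodes.N07Prop8StepCoPGridGOfPremises.collar_letter_eventually_linear` — its module `…N07Prop8StepCoPGridGOfPremises (MODULE 120)` is residue after the Stage-2 seam and can no longer be imported on a green road; statement and proof byte-identical to the original, visibility `private` (no new public name, nothing restated for citers). -/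
private theorem collar_letter_eventually_linear (Mc : ℕ) {CH BH δH Aκ : ℝ} (hCH : 0 ≤ CH) (hBH : 0 ≤ BH) (hδH : 0 < δH) (hAκ : 0 ≤ Aκ) :
    ∃ ρth : ℕ, ∀ ρ₀ : ℕ, ρth ≤ ρ₀ → ∀ κ : ℝ, 0 ≤ κ → κ ≤ Aκ * (ρ₀ : ℝ) →
      32 * ((sideP (F.P 0) Mc (ρ₀ * F.L) : ℕ) : ℝ) * CH * BH * Real.exp (-(δH * ((ρ₀ * F.L : ℕ) : ℝ))) * (κ * (F.L : ℝ)) ≤ 1 := by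
  have hL1 : (1 : ℝ) ≤ F.L := by exact_mod_cast (F.P 0).L_pos
  have hL0 : (0 : ℝ) ≤ F.L := by linarith
  set A₀ : ℝ := 32 * (((Mc : ℝ) + 44 + 2 * (F.L : ℝ)) * CH * BH * (Aκ * (F.L : ℝ))) with hA₀
  have hA₀0 : 0 ≤ A₀ := by positivity
  set A : ℝ := A₀ * (8 / δH ^ 2) * Real.exp (δH / 2) with hA
  have hA0 : 0 ≤ A := by positivity
  obtain ⟨R₁, hR₁⟩ := exists_collar_threshold hA0 one_pos (half_pos hδH)
  refine ⟨R₁, fun ρ₀ hρ κ hκ0 hκA => ?_⟩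
  have hρ0 : (0 : ℝ) ≤ ρ₀ := Nat.cast_nonneg _
  -- `sideP(Mc, ρ₀L) ≤ (Mc + 44 + 2L)(ρ₀ + 1)`, `κ ≤ Aκ(ρ₀ + 1)`
  have hS : ((sideP (F.P 0) Mc (ρ₀ * F.L) : ℕ) : ℝ) ≤ ((Mc : ℝ) + 44 + 2 * (F.L : ℝ)) * ((ρ₀ : ℝ) + 1) := by
    have h1 : ((sideP (F.P 0) Mc (ρ₀ * F.L) : ℕ) : ℝ) ≤ ((Mc + 11 * (F.P 0).d + 2 * (ρ₀ * F.L) : ℕ) : ℝ) := by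
      exact_mod_cast sideP_le (P := F.P 0) Mc (ρ₀ * F.L)
    have h2 : ((Mc + 11 * (F.P 0).d + 2 * (ρ₀ * F.L) : ℕ) : ℝ) = (Mc : ℝ) + 44 + 2 * ((ρ₀ : ℝ) * (F.L : ℝ)) := by rw [T4Family.P_d]; push_cast; ring
    rw [h2] at h1
    nlinarith [mul_nonneg (Nat.cast_nonneg Mc : (0 : ℝ) ≤ Mc) hρ0, mul_nonneg hρ0 hL0]
  have hS0 : 0 ≤ ((sideP (F.P 0) Mc (ρ₀ * F.L) : ℕ) : ℝ) := Nat.cast_nonneg _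
  have hκ1 : κ ≤ Aκ * ((ρ₀ : ℝ) + 1) := hκA.trans (by nlinarith)
  -- `e^{−δ ρ₀ L} ≤ e^{−δ ρ₀}`
  have hcast : ((ρ₀ * F.L : ℕ) : ℝ) = (ρ₀ : ℝ) * (F.L : ℝ) := by push_cast; ring
  have hEL : Real.exp (-(δH * ((ρ₀ * F.L : ℕ) : ℝ))) ≤ Real.exp (-(δH * (ρ₀ : ℝ))) := by
    rw [hcast, Real.exp_le_exp]
    have : δH * (ρ₀ : ℝ) * 1 ≤ δH * (ρ₀ : ℝ) * (F.L : ℝ) := mul_le_mul_of_nonneg_left hL1 (by positivity)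
    linarith
  have hE0 : 0 ≤ Real.exp (-(δH * ((ρ₀ * F.L : ℕ) : ℝ))) := (Real.exp_pos _).le
  have hE0' : 0 ≤ Real.exp (-(δH * (ρ₀ : ℝ))) := (Real.exp_pos _).le
  -- the weight
  have hsq : ((ρ₀ : ℝ) + 1) ^ 2 ≤ 8 / δH ^ 2 * Real.exp (δH / 2 * ((ρ₀ : ℝ) + 1)) := by
    have h1 := Real.pow_div_factorial_le_exp (δH / 2 * ((ρ₀ : ℝ) + 1)) (by positivity) 2
    have h2 : (δH / 2 * ((ρ₀ : ℝ) + 1)) ^ 2 / (Nat.factorial 2 : ℕ) = δH ^ 2 / 8 * ((ρ₀ : ℝ) + 1) ^ 2 := by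
      rw [Nat.factorial_two]; push_cast; ring
    rw [h2] at h1
    have hδ2 : 0 < δH ^ 2 := by positivity
    calc ((ρ₀ : ℝ) + 1) ^ 2 = 8 / δH ^ 2 * (δH ^ 2 / 8 * ((ρ₀ : ℝ) + 1) ^ 2) := by field_simp
      _ ≤ 8 / δH ^ 2 * Real.exp (δH / 2 * ((ρ₀ : ℝ) + 1)) := mul_le_mul_of_nonneg_left h1 (by positivity)
  have hexp : Real.exp (δH / 2 * ((ρ₀ : ℝ) + 1)) * Real.exp (-(δH * (ρ₀ : ℝ))) = Real.exp (δH / 2) * Real.exp (-(δH / 2 * (ρ₀ : ℝ))) := by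
    rw [← Real.exp_add, ← Real.exp_add]; congr 1; ring
  -- assemble
  have hmain : 32 * ((sideP (F.P 0) Mc (ρ₀ * F.L) : ℕ) : ℝ) * CH * BH * Real.exp (-(δH * ((ρ₀ * F.L : ℕ) : ℝ))) * (κ * (F.L : ℝ)) ≤
      A₀ * ((ρ₀ : ℝ) + 1) ^ 2 * Real.exp (-(δH * (ρ₀ : ℝ))) := by
    have h1 : ((sideP (F.P 0) Mc (ρ₀ * F.L) : ℕ) : ℝ) * κ ≤ (((Mc : ℝ) + 44 + 2 * (F.L : ℝ)) * ((ρ₀ : ℝ) + 1)) * (Aκ * ((ρ₀ : ℝ) + 1)) :=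
      mul_le_mul hS hκ1 hκ0 (by positivity)
    have h1' : 0 ≤ ((sideP (F.P 0) Mc (ρ₀ * F.L) : ℕ) : ℝ) * κ := mul_nonneg hS0 hκ0
    have e : 32 * ((sideP (F.P 0) Mc (ρ₀ * F.L) : ℕ) : ℝ) * CH * BH * Real.exp (-(δH * ((ρ₀ * F.L : ℕ) : ℝ))) * (κ * (F.L : ℝ)) =
        (((sideP (F.P 0) Mc (ρ₀ * F.L) : ℕ) : ℝ) * κ) * (32 * CH * BH * (F.L : ℝ)) * Real.exp (-(δH * ((ρ₀ * F.L : ℕ) : ℝ))) := by ring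
    have e' : A₀ * ((ρ₀ : ℝ) + 1) ^ 2 * Real.exp (-(δH * (ρ₀ : ℝ))) =
        ((((Mc : ℝ) + 44 + 2 * (F.L : ℝ)) * ((ρ₀ : ℝ) + 1)) * (Aκ * ((ρ₀ : ℝ) + 1))) * (32 * CH * BH * (F.L : ℝ)) * Real.exp (-(δH * (ρ₀ : ℝ))) := by
      rw [hA₀]; ring
    rw [e, e']
    exact mul_le_mul (mul_le_mul_of_nonneg_right h1 (by positivity)) hEL hE0 (by positivity)
  have hstep : A₀ * ((ρ₀ : ℝ) + 1) ^ 2 * Real.exp (-(δH * (ρ₀ : ℝ))) ≤ A * Real.exp (-(δH / 2 * (ρ₀ : ℝ))) := by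
    calc A₀ * ((ρ₀ : ℝ) + 1) ^ 2 * Real.exp (-(δH * (ρ₀ : ℝ)))
        ≤ A₀ * (8 / δH ^ 2 * Real.exp (δH / 2 * ((ρ₀ : ℝ) + 1))) * Real.exp (-(δH * (ρ₀ : ℝ))) :=
          mul_le_mul_of_nonneg_right (mul_le_mul_of_nonneg_left hsq hA₀0) hE0'
      _ = A * Real.exp (-(δH / 2 * (ρ₀ : ℝ))) := by
          rw [hA, mul_assoc (A₀ * (8 / δH ^ 2)) (Real.exp (δH / 2)), ← hexp]; ring
  exact hmain.trans (hstep.trans (hR₁ ρ₀ (by exact_mod_cast hρ)))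

/-- PRIVATE RE-HOME (director-ym №365 (2)–(4), row group 13′; R556): verbatim copy of `Summit.QuantumFields.YangMills.BalabanUVNodes.N07Prop8StepCoPGridGOfPremises.b9OfP_le_linear` — its module `…N07Prop8StepCoPGridGOfPremises (MODULE 120)` is residue after the Stage-2 seam and can no longer be imported on a green road; statement and proof byte-identical to the original, visibility `private` (no new public name, nothing restated for citers). -/
private theorem b9OfP_le_linear (Mc : ℕ) {B₁ : ℝ} (hB₁ : 0 ≤ B₁) {ρ₀ : ℕ} (hρ₀ : 1 ≤ ρ₀) :
    b9OfP F Mc (ρ₀ * F.L) B₁ ≤ (112 * (F.L : ℝ) ^ 5 * B₁ * ((F.L : ℝ) * Mc + 44 + 2 * (F.L : ℝ)) + 1) * (ρ₀ : ℝ) := by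
  have hρ : (1 : ℝ) ≤ ρ₀ := by exact_mod_cast hρ₀
  have hL0 : (0 : ℝ) ≤ F.L := Nat.cast_nonneg _
  unfold b9OfP
  push_cast
  have h1 : 0 ≤ 112 * (F.L : ℝ) ^ 5 * B₁ := by positivity
  have h3 : 0 ≤ ((F.L : ℝ) * Mc + 44) * ((ρ₀ : ℝ) - 1) := mul_nonneg (by positivity) (by linarith)
  have h2 : (F.L : ℝ) * Mc + 44 + 2 * ((ρ₀ : ℝ) * (F.L : ℝ)) ≤ ((F.L : ℝ) * Mc + 44 + 2 * (F.L : ℝ)) * (ρ₀ : ℝ) := by linarith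
  calc 112 * (F.L : ℝ) ^ 5 * B₁ * ((F.L : ℝ) * Mc + 44 + 2 * ((ρ₀ : ℝ) * (F.L : ℝ))) + 1
      ≤ 112 * (F.L : ℝ) ^ 5 * B₁ * (((F.L : ℝ) * Mc + 44 + 2 * (F.L : ℝ)) * (ρ₀ : ℝ)) + 1 * (ρ₀ : ℝ) :=
        add_le_add (mul_le_mul_of_nonneg_left h2 h1) (by linarith)
    _ = (112 * (F.L : ℝ) ^ 5 * B₁ * ((F.L : ℝ) * Mc + 44 + 2 * (F.L : ℝ)) + 1) * (ρ₀ : ℝ) := by ring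

section RehomedCrown

variable (N : ℕ) [NeZero N]

/-- PRIVATE RE-HOME (director-ym №365 (2)–(4), row group 13′; R556): verbatim copy of `Summit.QuantumFields.YangMills.BalabanUVNodes.N07JunctionHsupOfSmallness.sym152PhiEG_uniform_of_recordCrown` — its module `…N07JunctionHsupOfSmallness (MODULE 140)` is residue after the Stage-2 seam and can no longer be imported on a green road; statement and proof byte-identical to the original, visibility `private` (no new public name, nothing restated for citers). -/
private theorem sym152PhiEG_uniform_of_recordCrown (Mc : ℕ) (hcrown : RecordCrownSUPrecomp F.L N) :
    ∃ md ρmin : ℕ, ∃ Aκ : ℝ, 1 ≤ ρmin ∧ 0 ≤ Aκ ∧ ∀ ρ₀ : ℕ, ρmin ∣ ρ₀ → 1 ≤ ρ₀ →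
      ∃ κ a₀ ψc : ℝ, 0 < κ ∧ κ ≤ Aκ * (ρ₀ : ℝ) ∧ 0 < a₀ ∧ 0 ≤ ψc ∧
        HThm4RecSym152PhiEG F N Mc (ρ₀ * F.L) (F.L ^ md) κ a₀ (fun ε j => ψc * (κ * ε j) ^ 2) := by
  obtain ⟨B₀, c₁, ρc, M₀, N₀, R₀, hB₀, hc₁, hbody⟩ := hcrown
  obtain ⟨s, ρm, hρm, hC⟩ := datumCrownPhiAt_of_recordCrownSUPrecompBody F N hbody Mc
  obtain ⟨Aκ, hAκ, hK⟩ := exists_kappa_choice F Mc (zero_le_one.trans hB₀)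
  have hL0 : (0 : ℝ) < F.L := by exact_mod_cast (F.P 0).L_pos
  refine ⟨s + 1, Nat.lcm (F.L ^ s) ρm, Aκ, Nat.pos_of_ne_zero (Nat.lcm_ne_zero (pow_ne_zero _ (F.P 0).L_pos.ne') (by omega)), hAκ,
    fun ρ₀ hdiv hρ₀ => ?_⟩
  have hρ : F.L ≤ ρ₀ * F.L := Nat.le_mul_of_pos_left _ hρ₀
  have hdivc : ρm ∣ ρ₀ := (Nat.dvd_lcm_right _ _).trans hdiv
  have hdivs : F.L ^ s ∣ ρ₀ := (Nat.dvd_lcm_left _ _).trans hdiv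
  have hsρ : F.L ^ (s + 1) ∣ ρ₀ * F.L := by rw [pow_succ]; exact mul_dvd_mul hdivs dvd_rfl
  -- the φ-crown at this collar
  have hcrownAt := hC ρ₀ hdivc hρ₀ hρ
  -- the crown's constants and their signs
  have hM1 : (1 : ℝ) ≤ (sideP (F.P 0) Mc (ρ₀ * F.L) : ℝ) := by
    have hρ0 : 0 < ρ₀ * F.L := lt_of_lt_of_le (F.P 0).L_pos (by rw [T4Family.P_L]; exact hρ)
    have h := le_sideP (P := F.P 0) Mc hρ0
    exact_mod_cast (show 1 ≤ sideP (F.P 0) Mc (ρ₀ * F.L) by omega)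
  have hB₀' : (0 : ℝ) ≤ B₀ := zero_le_one.trans hB₀
  have hCr : (0 : ℝ) ≤ 560 * (F.L : ℝ) ^ 3 * B₀ * (sideP (F.P 0) Mc (ρ₀ * F.L) : ℝ) := by positivity
  have hCω : (0 : ℝ) ≤ 20 * (F.L : ℝ) * B₀ := by positivity
  have hω₁ : (0 : ℝ) < c₁ / 2 := by positivity
  have hα₁ : (0 : ℝ) < c₁ / (56 * (F.L : ℝ) ^ 2 * (sideP (F.P 0) Mc (ρ₀ * F.L) : ℝ)) := by positivity
  -- `κ` linear in `ρ₀`, a small fine letter, `ψc`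
  obtain ⟨κ, hκ0, hκA, hκlow⟩ := hK ρ₀ hρ₀
  obtain ⟨a₀, ha₀, h2, h9, h11, h12, h16, h13, h15, h18, hα⟩ :=
    exists_fineLetter_small F N (560 * (F.L : ℝ) ^ 3 * B₀ * (sideP (F.P 0) Mc (ρ₀ * F.L) : ℝ)) (20 * (F.L : ℝ) * B₀) hω₁ hα₁
  set W : ℝ := (830352 + 4 * (560 * (F.L : ℝ) ^ 3 * B₀ * (sideP (F.P 0) Mc (ρ₀ * F.L) : ℝ)) + 59719680 * (20 * (F.L : ℝ) * B₀)) * (F.L : ℝ) ^ 5 with hW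
  have hψ : 65536 * W ^ 2 ≤ (65536 * W ^ 2 / κ ^ 2) * κ ^ 2 := by
    rw [div_mul_cancel₀ _ (pow_ne_zero 2 hκ0.ne')]
  have hnum := hnum_of_smallness F N hCr hCω h2 h9 h11 h12 h16 h13 h15 h18 hκlow hψ
  exact ⟨κ, a₀, 65536 * W ^ 2 / κ ^ 2, hκ0, hκA, ha₀, by positivity,
    hThm4RecSym152PhiEG_of_junction_glued F N hρ hCr hCω hcrownAt hsρ hα (hJ_holds F N hρ hCr hCω hnum)⟩

end RehomedCrown

/-! ## §1  The stub-1-shaped text at print's datum from (P1-G) alone -/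

set_option maxHeartbeats 1600000 in
open scoped Classical in
/-- ★★★ **THE K0⁷ STUB-1-SHAPED TEXT AT PRINT's [II] (2.3) DATUM AND PRINT's (7) DATA, FROM THE COLLAR-UNIFORM CONDITIONAL PREMISE (P1-G) ALONE — NO SEAM** (print-datum twin of 125's
`prop8StepCoPGridGAt_of_sym152PhiEG_uniform_of_seam`, FLAG №16 ∕ LOCATE-HSEAM 5d3298b8d191f169; the (b)-instance stays landed and true on its own text): for a grid side `Mc ≥ 1`, (P1-G) (row 9′ =
N05's (B′) road at the dented datum) gives integers `c c₀ c₁` and `B₃ ≥ 2L²`, `a₀, a₁ > 0` with `Prop8RegSepTopStepGB F 2 suppDom (grid guard c c₀ c₁) (lamDatum F) (dataSmall7LamTopOf F 2) B₃ a₀ a₁`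
— 125 §2's proof verbatim over the print-datum closed head 124′. [cite: Balaban1985Variational, Prop. 8 p.304, (7) p.278, (144) p.300, (147)–(163) pp.301–304; Balaban1985RegularSpaces, Thm. 4 p.88, Prop. 6 (1.130)–(1.138) p.99; Balaban1984PropagatorsII, (2.3) p.224; Balaban1987RG1, (0.1) p.251, (0.4), (0.11) p.253; Balaban1988Convergent, (2.5) p.255] -/
theorem exists_prop8RegSepTopStepGB_lam_of_sym152PhiEG_uniform (Mc : ℕ) (hMc : 1 ≤ Mc)
    -- ★ (P1-G) THE CONDITIONAL PREMISE, COLLAR-UNIFORM, GUARD EDITION ((c-ii)‴ at modulus `L^md`; N05's (B′) road ∕ n07-w3's junction at the dented datum)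
    (hTU : ∃ md ρmin : ℕ, ∃ Aκ : ℝ, 1 ≤ ρmin ∧ 0 ≤ Aκ ∧ ∀ ρ₀ : ℕ, ρmin ∣ ρ₀ → 1 ≤ ρ₀ →
      ∃ κ a₀ ψc : ℝ, 0 < κ ∧ κ ≤ Aκ * (ρ₀ : ℝ) ∧ 0 < a₀ ∧ 0 ≤ ψc ∧ HThm4RecSym152PhiEG F 2 Mc (ρ₀ * F.L) (F.L ^ md) κ a₀ (fun ε j => ψc * (κ * ε j) ^ 2)) :
    ∃ (c c₀ c₁ : ℕ) (B₃ a₀ a₁ : ℝ), 2 * (F.L : ℝ) ^ 2 ≤ B₃ ∧ 0 < a₀ ∧ 0 < a₁ ∧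
      Prop8RegSepTopStepGB F 2 (fun ν K Ω => suppDomOfRecord F ν K Ω)
        (fun ν M g K k _s => c ≤ ν.M₁ ∧ k + c₀ ≤ F.m + K ∧ F.L ^ c₁ ∣ M ∧
          ∀ i, 1 ≤ i → i ≤ k → dCubeSide (F.P K).L M (RkOfRecord (F.P K).L ν.r (g i)) i ∣ (F.P K).sitesPerDir 0)
        (lamDatum F) (dataSmall7LamTopOf F 2) B₃ a₀ a₁ := by
  obtain ⟨Mh₀, R₀, CH, δH, BH, hCH, hδH, hBH, hhead⟩ := prop8RegSepTopStepGB_of_hThm4RecSym152PhiEG_closed_lam F 2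
  obtain ⟨md, ρmin, Aκ, hρmin, hAκ, hU⟩ := hTU
  obtain ⟨ρth, hth⟩ := collar_letter_eventually_linear F Mc hCH hBH.le hδH hAκ
  have hL1 : 1 ≤ F.L := (F.P 0).L_pos
  have hL2 : 2 ≤ F.L := by have := F.hL11; omega
  -- the K0 witness's integers
  set a' : ℕ := Mh₀ + md with ha'
  set Mh : ℕ := F.L ^ a' with hMh
  have hMh₀ : Mh₀ ≤ Mh :=
    calc Mh₀ ≤ Mh₀ + md := Nat.le_add_right _ _
      _ ≤ F.L ^ (Mh₀ + md) := (Nat.lt_pow_self (by omega : 1 < F.L)).le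
      _ = Mh := by rw [hMh]
  -- the junction's dent modulus divides the chain's: `L^md ∣ L·M_h = L^{a′+1}`
  have hmdMh : F.L ^ md ∣ F.L * Mh := by
    rw [hMh, ha', ← pow_succ']
    exact pow_dvd_pow F.L (by omega)
  have hMh1 : 1 ≤ Mh := Nat.one_le_pow _ _ (by omega)
  set R : ℕ := R₀ + 2 with hR
  set t : ℕ := ρth + R + Mc + 1 with ht
  set ρ₀ : ℕ := ρmin * Mh * t with hρ₀
  have ht1 : 1 ≤ t := by omega
  have hρ₀1 : 1 ≤ ρ₀ := by
    rw [hρ₀]; exact Nat.one_le_iff_ne_zero.mpr (by positivity)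
  have hρ₀t : t ≤ ρ₀ := by
    rw [hρ₀]; exact Nat.le_mul_of_pos_left t (by positivity)
  have hρ₀d : ρmin ∣ ρ₀ := ⟨Mh * t, by rw [hρ₀]; ring⟩
  set ρ : ℕ := ρ₀ * F.L with hρ
  have hρt : t ≤ ρ := hρ₀t.trans (Nat.le_mul_of_pos_right ρ₀ (by omega))
  have hMcρ : Mc ≤ ρ := by omega
  have hLρ : F.L ≤ ρ := by rw [hρ]; exact Nat.le_mul_of_pos_left F.L (by omega)
  have hdvd : F.L * Mh ∣ ρ := ⟨ρmin * t, by rw [hρ, hρ₀]; ring⟩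
  have hRρ : R * (F.L * Mh) ≤ ρ := by
    have h1 : R ≤ ρmin * t :=
      calc R ≤ t := by omega
        _ = 1 * t := (one_mul t).symm
        _ ≤ ρmin * t := Nat.mul_le_mul_right t hρmin
    calc R * (F.L * Mh) ≤ (ρmin * t) * (F.L * Mh) := Nat.mul_le_mul_right _ h1
      _ = ρ := by rw [hρ, hρ₀]; ring
  have hRM : 2 * F.L ≤ R * (F.L * Mh) + 1 := by
    have h1 : 2 * F.L ≤ R * (F.L * Mh) := by
      calc 2 * F.L = 2 * (F.L * 1) := by ring
        _ ≤ R * (F.L * Mh) := Nat.mul_le_mul (by omega) (Nat.mul_le_mul_left _ hMh1)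
    omega
  set c : ℕ := (11 * 4 + 4 * ρ + Mc + 3) * F.L with hc
  set c₀ : ℕ := Mc + 11 * 4 + 6 * ρ + 1 + F.m + a' + 3 with hc₀
  have hc₀row : Mc + 11 * 4 + 6 * ρ + 1 ≤ 2 * F.L ^ c₀ := by
    have h1 : c₀ ≤ F.L ^ c₀ := (Nat.lt_pow_self (by omega : 1 < F.L)).le
    omega
  have hmc₀ : F.m ≤ c₀ := by omega
  have hac₀ : a' + 3 ≤ c₀ := by omega
  set c₁ : ℕ := a' + 1 with hc₁
  -- the grid guard of the registered text
  set Adm : StepGuard F := fun ν M g K k _s => c ≤ ν.M₁ ∧ k + c₀ ≤ F.m + K ∧ F.L ^ c₁ ∣ M ∧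
      ∀ i, 1 ≤ i → i ≤ k → dCubeSide (F.P K).L M (RkOfRecord (F.P K).L ν.r (g i)) i ∣ (F.P K).sitesPerDir 0 with hAdm
  have hAdm₁ : ∀ (ν : Stage7Numerics) (M : ℕ) (g : ℕ → ℝ) (K k : ℕ) (s : SeqOfRecord F ν M g K k), Adm ν M g K k s → c ≤ ν.M₁ ∧ k + c₀ ≤ F.m + K :=
    fun ν M g K k s h => ⟨h.1, h.2.1⟩
  have hAdm₂ : ∀ (ν : Stage7Numerics) (M : ℕ) (g : ℕ → ℝ) (K k : ℕ) (s : SeqOfRecord F ν M g K k), Adm ν M g K k s → ∀ j : ℕ, 1 ≤ j → j ≤ k →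
      F.L * Mh ∣ M * RkOfRecord (F.P K).L ν.r (g j) ∧ dCubeSide (F.P K).L M (RkOfRecord (F.P K).L ν.r (g j)) j ∣ (F.P K).sitesPerDir 0 := by
    intro ν M g K k s h j hj1 hjk
    refine ⟨?_, h.2.2.2 j hj1 hjk⟩
    have h1 : F.L * Mh = F.L ^ c₁ := by rw [hMh, hc₁, pow_succ]; ring
    rw [h1]
    exact Dvd.dvd.mul_right h.2.2.1 _
  -- (P1) at the chosen collar; the collar letter
  obtain ⟨κ, amax, ψc, hκ, hκA, hamax, hψc, hT0⟩ := hU ρ₀ hρ₀d hρ₀1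
  have hcollar : 32 * ((sideP (F.P 0) Mc ρ : ℕ) : ℝ) * CH * BH * Real.exp (-(δH * (ρ : ℝ))) * (κ * (F.L : ℝ)) ≤ 1 :=
    hth ρ₀ (by omega) κ hκ.le hκA
  -- the closed head
  obtain ⟨a₀, ha₀, ha₀max, hrest⟩ :=
    hhead (ρ := ρ) (Mc := Mc) (Mh := Mh) (R := R) (a' := a') hMc hMcρ hMh hMh₀ (by omega) hdvd hRρ hLρ hRM (c := c) (c₀ := c₀) le_rfl hc₀row hmc₀ hac₀ Adm hAdm₁ hAdm₂
      hκ hψc hamax hcollar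
  have hT : HThm4RecSym152PhiEG F 2 Mc ρ (F.L * Mh) κ a₀ (fun ε j => ψc * (κ * ε j) ^ 2) :=
    hThm4RecSym152PhiEG_mono hκ le_rfl ha₀max (fun _ _ => le_rfl) hmdMh hT0
  obtain ⟨B₃, a₁, hB₃L, ha₁, htok⟩ := hrest hT
  exact ⟨c, c₀, c₁, B₃, a₀, a₁, hB₃L, ha₀, ha₁, htok⟩

/-! ## §2  (P1′-G): (P1-G) at the print letters `b9OfP ∕ a0OfP` -/

set_option maxHeartbeats 800000 in
open scoped Classical in
/-- ★★ **THE TEXT FROM (P1′-G) AT THE PRINT LETTERS** (print-datum twin of 125 §3; `κ ≤ Aκ·ρ₀` by 120 §3 `b9OfP_le_linear`, `0 < a₀` by `a0OfP_pos`). [cite: Balaban1985Variational, Prop. 8 p.304, (152) p.301, (163) p.304; Balaban1985RegularSpaces, Prop. 6 (1.130)–(1.138) p.99; Balaban1984PropagatorsII, (2.3) p.224; Balaban1988Convergent, (2.5) p.255] -/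
theorem exists_prop8RegSepTopStepGB_lam_of_sym152PhiEG_printLetters (Mc : ℕ) (hMc : 1 ≤ Mc)
    (hTP : ∃ md ρmin : ℕ, ∃ B₁ c₁ ψc : ℝ, 1 ≤ ρmin ∧ 0 ≤ B₁ ∧ 0 < c₁ ∧ 0 ≤ ψc ∧ ∀ ρ₀ : ℕ, ρmin ∣ ρ₀ → 1 ≤ ρ₀ →
      HThm4RecSym152PhiEG F 2 Mc (ρ₀ * F.L) (F.L ^ md) (b9OfP F Mc (ρ₀ * F.L) B₁) (a0OfP F 2 Mc (ρ₀ * F.L) B₁ c₁)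
        (fun ε j => ψc * (b9OfP F Mc (ρ₀ * F.L) B₁ * ε j) ^ 2)) :
    ∃ (c c₀ c₁ : ℕ) (B₃ a₀ a₁ : ℝ), 2 * (F.L : ℝ) ^ 2 ≤ B₃ ∧ 0 < a₀ ∧ 0 < a₁ ∧
      Prop8RegSepTopStepGB F 2 (fun ν K Ω => suppDomOfRecord F ν K Ω)
        (fun ν M g K k _s => c ≤ ν.M₁ ∧ k + c₀ ≤ F.m + K ∧ F.L ^ c₁ ∣ M ∧
          ∀ i, 1 ≤ i → i ≤ k → dCubeSide (F.P K).L M (RkOfRecord (F.P K).L ν.r (g i)) i ∣ (F.P K).sitesPerDir 0)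
        (lamDatum F) (dataSmall7LamTopOf F 2) B₃ a₀ a₁ := by
  obtain ⟨md, ρmin, B₁, c₁, ψc, hρmin, hB₁, hc₁, hψc, h⟩ := hTP
  refine exists_prop8RegSepTopStepGB_lam_of_sym152PhiEG_uniform F Mc hMc
    ⟨md, ρmin, 112 * (F.L : ℝ) ^ 5 * B₁ * ((F.L : ℝ) * Mc + 44 + 2 * (F.L : ℝ)) + 1, hρmin, by positivity, fun ρ₀ hd h1 => ?_⟩
  refine ⟨b9OfP F Mc (ρ₀ * F.L) B₁, a0OfP F 2 Mc (ρ₀ * F.L) B₁ c₁, ψc, ?_, b9OfP_le_linear F Mc hB₁ h1, a0OfP_pos Mc (ρ₀ * F.L) hB₁ hc₁, hψc, h ρ₀ hd h1⟩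
  unfold b9OfP
  have hL0 : (0 : ℝ) ≤ F.L := Nat.cast_nonneg _
  positivity

/-! ## §3  From the record crown; unconditionally for `N = 2` -/

/-- ★★★ **THE TEXT FROM THE RECORD CROWN** (print-datum twin of 140's `prop8StepCoPGridGAt_of_recordCrown_of_seam`, NO SEAM): (P1-G) is 140 thm 1 `sym152PhiEG_uniform_of_recordCrown` (datum-free,
✓p764312). [cite: Balaban1985RegularSpaces, Prop. 8 p.100; Balaban1985Variational, (147)–(153) p.301, Prop. 8 p.304; Balaban1984PropagatorsII, (2.3) p.224; Balaban1988Convergent, (2.1)–(2.5) pp.254–255] -/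
theorem exists_prop8RegSepTopStepGB_lam_of_recordCrown (Mc : ℕ) (hMc : 1 ≤ Mc) (hcrown : RecordCrownSUPrecomp F.L 2) :
    ∃ (c c₀ c₁ : ℕ) (B₃ a₀ a₁ : ℝ), 2 * (F.L : ℝ) ^ 2 ≤ B₃ ∧ 0 < a₀ ∧ 0 < a₁ ∧
      Prop8RegSepTopStepGB F 2 (fun ν K Ω => suppDomOfRecord F ν K Ω)
        (fun ν M g K k _s => c ≤ ν.M₁ ∧ k + c₀ ≤ F.m + K ∧ F.L ^ c₁ ∣ M ∧
          ∀ i, 1 ≤ i → i ≤ k → dCubeSide (F.P K).L M (RkOfRecord (F.P K).L ν.r (g i)) i ∣ (F.P K).sitesPerDir 0)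
        (lamDatum F) (dataSmall7LamTopOf F 2) B₃ a₀ a₁ :=
  exists_prop8RegSepTopStepGB_lam_of_sym152PhiEG_uniform F Mc hMc (sym152PhiEG_uniform_of_recordCrown F 2 Mc hcrown)

/-- ★★★★ **THE K0⁷ STUB-1-SHAPED TEXT AT PRINT's [II] (2.3) DATUM AND PRINT's (7) DATA, WITH NO DISPLAYED PREMISE** (`N = 2`, `1 ≤ Mc`) — print-datum twin of 140's `prop8StepCoPGridGAt_of_seam`
(FLAG №16 ∕ LOCATE-HSEAM 5d3298b8d191f169; the (b)-instance stays landed and true on its own text): the ONLY premise of 140 thm 3, HSEAM, is ABSENT — definitionally void at `bd := lamDatum F`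
(HONESTY GUARD №338 (5), 140′: see the file header; nothing else deleted or weakened; the conclusion re-keyed to the print-datum token).  The record crown is UNCONDITIONAL for `N ≤ 25`
(dag-n05-e `recordCrownSUPrecomp_holds_of_le`).  NOT the registered V22-Z text; closes no registered statement (V23 decides).
[cite: Balaban1985RegularSpaces, Prop. 8 p.100, Thm. 4 p.88, Prop. 6 (1.130)–(1.138) p.99; Balaban1985Variational, (7) p.278, (147)–(153) p.301, Sect. F pp.300–304, Prop. 8 p.304; Balaban1984PropagatorsII, (2.3) p.224; Balaban1988Convergent, (2.1)–(2.5) pp.254–255, (2.10) p.256] -/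
theorem exists_prop8RegSepTopStepGB_lam (Mc : ℕ) (hMc : 1 ≤ Mc) :
    ∃ (c c₀ c₁ : ℕ) (B₃ a₀ a₁ : ℝ), 2 * (F.L : ℝ) ^ 2 ≤ B₃ ∧ 0 < a₀ ∧ 0 < a₁ ∧
      Prop8RegSepTopStepGB F 2 (fun ν K Ω => suppDomOfRecord F ν K Ω)
        (fun ν M g K k _s => c ≤ ν.M₁ ∧ k + c₀ ≤ F.m + K ∧ F.L ^ c₁ ∣ M ∧
          ∀ i, 1 ≤ i → i ≤ k → dCubeSide (F.P K).L M (RkOfRecord (F.P K).L ν.r (g i)) i ∣ (F.P K).sitesPerDir 0)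
        (lamDatum F) (dataSmall7LamTopOf F 2) B₃ a₀ a₁ :=
  exists_prop8RegSepTopStepGB_lam_of_recordCrown F Mc hMc (recordCrownSUPrecomp_holds_of_le F 2 (by norm_num))

end Summit.QuantumFields.YangMills.BalabanUVNodes.N07Prop8StepCoPGridGAtLam

end
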